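import Mathlib
import Summits.KontsevichZagierPeriods.Zeta5Search.LongClassStructure52
import Summits.KontsevichZagierPeriods.Zeta5Search.LongClassCheck52B
import Summits.KontsevichZagierPeriods.Zeta5Search.ShapeClauseTransfer
import Summits.KontsevichZagierPeriods.Zeta5Search.FourthOrderFrameExp
import Summits.KontsevichZagierPeriods.Zeta5Search.ZeroWindowKit
import Summits.KontsevichZagierPeriods.Zeta5Search.CollinearityOrbits
import Summits.KontsevichZagierPeriods.Zeta5Search.LawA5Proof
import HarnessLib

/-!
# ζ(5) search — THE RECORD WINDOW L5 / `M = 52` IS A THEOREM: `v_p(Cas₇(b(n))) ≥ −96` on `θ = p/n ∈ (1, 25/24]`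

Cell `pub-zeta5` (HONEST FRAMING: systematic search; no irrationality claim unless certified), typer seat generation 13.
Discharges BY NAME `SecondResidueLaw.RecShapesM52` (the class structure of the record datum `b(n)` on the window
`n < p ≤ 25n/24`: the `LawA4` clauses and the shape clause (T4) with frame `(52, T52)`, for `b(n)` and `b(n) + e₇`) and hence
`SecondResidueLaw.RecWindowL5M52`: **`v_p(Cas₇(b(n))) ≥ −96 = 8 − 2·52`**, the Brown–Zudilin value, for every `n ≥ 2` and every prime
`p` of the window with `41n + 2 < p²` — from THEOREM L5 (`lawA5_holds`) and the landed reduction `recWindowL5M52_of`.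
Proof of the class structure: the structure theorem `longClass52` (type list = `F52` of a coded carry tuple with `N52`), the finite
check `decide52_J0/J1/J2` (`good52`), the list/class dictionary (pole count, exponent = list sum + odd-centre term, palindromy of
self-conjugate classes, the even centre as a level), the raise certificates `G1_isRaise`/`G2_isRaise2`/`G3_isRaiseN`/`G2P_isRaiseN`,
and the transport to `b(n) + e₇` (`recFrameL5_of_unshifted`).  Valuations of rationals; nothing here bears on irrationality.
-/

namespace Summit.KontsevichZagierPeriods.Zeta5Search.LongClass

open Finset
open Summit.KontsevichZagierPeriods.Zeta5Search.ClusterValuation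
open Summit.KontsevichZagierPeriods.Zeta5Search.SecondOrder (topLevel classTypeList classTypeList_level level_bounds' isRaise isRaise2
  lawA5_holds classNu_eq_of_multipole recFrameL5_of_unshifted)
open Summit.KontsevichZagierPeriods.Zeta5Search.LevelClass (classSet_level level_injective classPoles_level)
open Summit.KontsevichZagierPeriods.Zeta5Search.RecordWindowsA4 (LawA4Classes T52)
open Summit.KontsevichZagierPeriods.Zeta5Search.SecondResidueLaw (isRaiseN ShapeClause RecFrameL5 RecShapesM52 RecWindowL5M52
  recWindowL5M52_of)

variable {p : ℕ} [hp : Fact p.Prime]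

/-! ## §1 Dictionary: class data from the type list -/

omit hp in
/-- A `Finset.range` sum as the sum of the mapped `List.range`. -/
theorem sum_range_eq_list_sum (f : ℕ → ℤ) (m : ℕ) : ∑ k ∈ range m, f k = ((List.range m).map f).sum := by
  induction m with
  | zero => simp
  | succ m ih => rw [sum_range_succ, List.range_succ, List.map_append, List.sum_append, ih]; simp

section Dict

variable (b : ℕ → ℤ) {x L : ℕ} (hx : x < p) (hL : x + L * p ≤ (b 0).toNat) (hL' : (b 0).toNat < x + L * p + p)
include hx hL hL'

/-- **Exponent = list sum + odd-centre term.** -/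
theorem classExp_eq_listSum : classExp b p x = (classTypeList b p x).sum + (if ¬ (2 : ℤ) ∣ b 0 ∧ CentreIn b p x then 1 else 0) := by
  unfold classExp
  rw [classSet_level b hx hL hL', sum_image (fun a _ c _ h => level_injective hp.out.pos x h), classTypeList_level b hL hL',
    sum_range_eq_list_sum]

/-- **Pole count = number of negative entries of the type list.** -/
theorem classPoleCount_eq_length :
    classPoleCount b p x = ((classTypeList b p x).filter fun v => v < 0).length := by
  have hP := classPoles_level b hx hL hL' (fun k => netExp b (x + k * p)) (fun _ _ => rfl)
  have h1 : classPoleCount b p x = (CellA.classPoles b p x).card := rfl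
  rw [h1, hP, card_image_of_injective _ (level_injective hp.out.pos x), classTypeList_level b hL hL', List.filter_map]
  simp only [List.length_map]
  rfl

end Dict

/-- **The even centre is a level of a self-conjugate class** (`n` even, `x < p`, `p` odd). -/
theorem centre_level {n x : ℕ} (hp2 : p ≠ 2) (hx : x < p) (hev : 2 ∣ n) (hcen : CentreIn (bRec n) p x) :
    ∃ k ≤ topLevel (bRec n) p x, 2 * (x + k * p) = 41 * n := by
  obtain ⟨m, rfl⟩ := hev
  have hb0 := CellA.bRec_zero_toNat (2 * m)
  unfold CentreIn at hcen
  rw [CellA.bRec_zero] at hcen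
  have h2 : (p : ℤ) ∣ ((x : ℤ) - (41 * m : ℕ)) * 2 := by
    have : (2 : ℤ) * x - 41 * ((2 * m : ℕ) : ℤ) = ((x : ℤ) - (41 * m : ℕ)) * 2 := by push_cast; ring
    rwa [this] at hcen
  have hcop : IsCoprime (p : ℤ) 2 := by
    have := Nat.isCoprime_iff_coprime.2 ((Nat.coprime_primes hp.out Nat.prime_two).2 hp2)
    simpa using this
  have hpm : (p : ℤ) ∣ (x : ℤ) - (41 * m : ℕ) := hcop.dvd_of_dvd_mul_right h2
  rcases Nat.lt_or_ge (41 * m) x with hlt | hle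
  swap
  · have hd : p ∣ 41 * m - x := by
      have : ((x : ℤ) - (41 * m : ℕ)) = -(((41 * m - x : ℕ) : ℤ)) := by rw [Nat.cast_sub hle]; ring
      rw [this, dvd_neg] at hpm; exact_mod_cast hpm
    obtain ⟨k, hk⟩ := hd
    have hk' : 41 * m - x = k * p := by rw [hk, Nat.mul_comm]
    refine ⟨k, ?_, by omega⟩
    have hkp : k * p ≤ (bRec (2 * m) 0).toNat - x := by rw [hb0]; omega
    exact (Nat.le_div_iff_mul_le hp.out.pos).2 hkp
  · exfalso
    have hd : p ∣ x - 41 * m := by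
      have : ((x : ℤ) - (41 * m : ℕ)) = ((x - 41 * m : ℕ) : ℤ) := by rw [Nat.cast_sub hlt.le]
      rw [this] at hpm; exact_mod_cast hpm
    have := Nat.eq_zero_of_dvd_of_lt hd (by omega)
    omega

/-! ## §2 The class structure of `b(n)` on the window -/

/-- **Every class of `b(n)` on the window `n < p ≤ 25n/24` satisfies the L5 frame clauses with `(M, T) = (52, T52)`.** -/
theorem class52 (n x : ℕ) (hn2 : 2 ≤ n) (hnp : n < p) (hw : 24 * p ≤ 25 * n) (hx : x < p) :
    2 ≤ classPoleCount (bRec n) p x ∧ -52 ≤ classExp (bRec n) p x ∧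
    (classExp (bRec n) p x = -52 → ¬ CentreIn (bRec n) p x ∧ classTypeList (bRec n) p x = T52) ∧
    (classExp (bRec n) p x = -51 → isRaise T52 (classTypeList (bRec n) p x) = true ∨
      (¬ (2 : ℤ) ∣ bRec n 0 ∧ CentreIn (bRec n) p x ∧ classTypeList (bRec n) p x = T52)) ∧
    (classExp (bRec n) p x = -50 → isRaise2 T52 (classTypeList (bRec n) p x) = true) ∧
    (classExp (bRec n) p x = -49 → isRaiseN 3 T52 (classTypeList (bRec n) p x) = true ∨
      (¬ (2 : ℤ) ∣ bRec n 0 ∧ CentreIn (bRec n) p x ∧ isRaiseN 2 T52 (classTypeList (bRec n) p x) = true)) := by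
  have hp0 : 0 < p := hp.out.pos
  have hb0 := CellA.bRec_zero_toNat n
  have hb0Z : bRec n 0 = ((41 * n : ℕ) : ℤ) := by rw [CellA.bRec_zero]; push_cast; ring
  have h0 : 0 ≤ bRec n 0 := by rw [hb0Z]; positivity
  have hxn : x ≤ (bRec n 0).toNat := by rw [hb0]; omega
  have hpn' : p ≤ (bRec n 0).toNat := by rw [hb0]; omega
  obtain ⟨hL, hL'⟩ := level_bounds' (p := p) (bRec n) hxn
  set L := topLevel (bRec n) p x with hLdef
  -- the structure theorem and the finite check
  obtain ⟨c0, u, k1, d, e1, e2, kc, hc0, hu, he1, he2, hkc, hcode, hN, hTL, hlist, hkap⟩ := longClass52 n x hnp hw hx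
  set T := mk52 c0 u k1 d e1 e2 kc with hT
  have hgood : good52 T = true := by
    rcases hcode with ⟨rfl, rfl, rfl, rfl⟩ | ⟨hk1, rfl, rfl⟩ | ⟨hk1, hd⟩
    · exact decide52_J0 hc0 hu hkc hN
    · exact decide52_J1 hc0 hu hk1 he1 hkc hN
    · exact decide52_J2 hc0 hu hk1 hd he1 he2 hkc hN
  obtain ⟨hpoles, hS52, hC3, hC4, hC5, hT4, hB⟩ := good52_spec hgood
  rw [← hlist] at hpoles hS52 hC3 hC4 hC5 hT4 hB
  rw [hTL] at hB hC3
  -- dictionary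
  have hE := classExp_eq_listSum (bRec n) hx hL hL'
  have hP := classPoleCount_eq_length (bRec n) hx hL hL'
  have hpal : CentreIn (bRec n) p x → (classTypeList (bRec n) p x).reverse = classTypeList (bRec n) p x := fun hcen => by
    rw [← ZeroWindows.classTypeList_conj (bRec n) h0 hx hL hL', (centreIn_iff_conjClass_eq (bRec n) hpn' hx).1 hcen]
  -- the even centre is a level of the class
  have hp2 : p ≠ 2 := by omega
  have hlev : CentreIn (bRec n) p x → (2 : ℤ) ∣ bRec n 0 → ∃ k ≤ L, 2 * (x + k * p) = 41 * n := fun hcen hev => by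
    have hev' : 2 ∣ n := by rw [CellA.bRec_zero] at hev; obtain ⟨c, hc⟩ := hev; omega
    exact centre_level hp2 hx hev' hcen
  -- the odd / even centre split
  by_cases hodd : ¬ (2 : ℤ) ∣ bRec n 0 ∧ CentreIn (bRec n) p x
  · -- odd-centre class: `E = S + 1`, palindromic list, no centre level
    rw [if_pos hodd] at hE
    have hp' := hpal hodd.2
    have habs : L + 1 ≤ T.kap := by
      by_contra h
      obtain ⟨k, -, hk⟩ := hkap.1 (by omega)
      apply hodd.1; rw [hb0Z]; exact ⟨(x : ℤ) + k * p, by push_cast; omega⟩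
    obtain ⟨hB1, hB2⟩ := hB habs hp'
    refine ⟨by omega, by omega, fun h => ?_, fun h => Or.inr ⟨hodd.1, hodd.2, (hC3 (by omega)).1⟩, fun h => ?_, fun h => ?_⟩
    · exfalso; omega
    · exfalso; exact hB1 (by omega)
    · exact Or.inr ⟨hodd.1, hodd.2, G2P_isRaiseN _ (hB2 (by omega))⟩
  · rw [if_neg hodd, add_zero] at hE
    refine ⟨by omega, by omega, fun h => ⟨fun hcen => ?_, (hC3 (by omega)).1⟩, fun h => Or.inl (G1_isRaise _ (hC4 (by omega))),
      fun h => G2_isRaise2 _ (hC5 (by omega)), fun h => Or.inl (G3_isRaiseN _ (hT4 (by omega)))⟩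
    -- a deep class is not self-conjugate: an even centre would be a level, but the centre code is absent
    have hev : (2 : ℤ) ∣ bRec n 0 := by by_contra hne; exact hodd ⟨hne, hcen⟩
    have hk := hkap.2 (hlev hcen hev)
    have := (hC3 (by omega)).2
    omega

/-- **`RecShapesM52` is a theorem**: the L5 frame `(52, T52)` of the record ray on `θ ∈ (1, 25/24]`. -/
theorem recShapesM52_holds : RecShapesM52 := by
  intro n p hn hprime h1 h2 _h3
  haveI : Fact p.Prime := ⟨hprime⟩
  have hcls := fun x (hx : x < p) => class52 (p := p) n x hn h1 h2 hx
  refine recFrameL5_of_unshifted (by omega) hprime (by omega) (by norm_num) ⟨?_, ?_, ?_, ?_, ?_⟩ ?_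
  · intro x hx
    have hx' := (mem_filter.1 hx).1; rw [mem_range] at hx'
    have := (hcls x hx').2.1; push_cast; omega
  · intro y hy h1y; have := (hcls y hy).1; omega
  · intro x hx hE
    have hx' := (mem_filter.1 hx).1; rw [mem_range] at hx'
    exact (hcls x hx').2.2.1 (by push_cast at hE; omega)
  · intro y hy _ hν
    have h := hcls y hy
    rw [classNu_eq_of_multipole (bRec n) h.1] at hν
    exact h.2.2.2.1 (by push_cast at hν; omega)
  · intro z hz _ hν
    have h := hcls z hz
    rw [classNu_eq_of_multipole (bRec n) h.1] at hν
    exact h.2.2.2.2.1 (by push_cast at hν; omega)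
  · intro z hz _ hν
    have h := hcls z hz
    rw [classNu_eq_of_multipole (bRec n) h.1] at hν
    exact h.2.2.2.2.2 (by push_cast at hν; omega)

/-- **THE RECORD WINDOW L5 / `M = 52` (`−96`, the Brown–Zudilin value) is a theorem.** -/
theorem recWindowL5M52_holds : RecWindowL5M52 := recWindowL5M52_of lawA5_holds recShapesM52_holds

end Summit.KontsevichZagierPeriods.Zeta5Search.LongClass
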